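import Summits.QuantumFields.YangMills.Theorems.UnitScaleTiltProp7TorusGreen2GradientBound
import Summits.QuantumFields.YangMills.Theorems.UnitScaleTiltProp7TorusGreen2HessianDecay
import Literature.MathematicalPhysics.QuantumFieldTheory.Balaban1983to89.B5Eq117TorusCarriers
import HarnessLib

/-!
# Route `UnitScaleTilt`, crux K1 «MinimiserStabilityRegPr» (stmt-QuantumFields-19200), route-R E′ path (α′), (E1-b) sibling (hK₀): THE SIZE DECAY OF THE TORUS GREEN FUNCTION IN
# `d = 3`, UNIFORM IN THE PERIOD — `|G̃_L(z)|·√(Σ_μ z̃_μ²) ≤ C` for `z ≠ 0` in `(ℤ/Lℤ)³` (`G̃_L = torusGreen`, zero mode removed; `z̃ = valMinAbs`): the lattice, finite-volume form of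
# `|x|⁻¹`, i.e. the Newtonian SIZE row that the zeroth-order kernel bound (hK₀) `Σ_z|Δ_zG(x,z)| ≲ ℓ²` feeds on (near field `Σ_{r≤ℓ} r²·r⁻¹ ≍ ℓ²`) through ✓ `exists_green_site_split`'s `hLf`

Cell `ym3-torus`, width seat `ym3-torus-px4` (gen 2); ★ym-ust-19200-p1 g15 20:45:05Z NAMER round 3 «(E1-b) (hK₀)(hK)(hK₂) [… px4]», ★routeR-w3 g5 (E1) LOCATE §3 (hK₀); offered 20:5xZ «px4:
(G₁-SIZE-3)».  The SIZE sibling of ✓ `Prop7TorusGreenGradientDecay.torusGreen_grad_mul_dist_sq_le` (★routeR-w3 g5, gradient) and ✓ `Prop7TorusGreenHessianDecay.torusGreen_hessian_mul_dist_cube_le`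
(ym-routeR-w6 g5, Hessian), by the same heat-kernel route.  THEOREMS ONLY (0 `def`, 0 `sorry`); `--supports stmt-QuantumFields-19200`, count-neutral.  YM₃ on T³ is a ladder rung (R3), not the
Clay problem; nothing here claims the stub, the crux, d = 4 or the gap.

WHAT IS PROVED (ns `…Theorems.Prop7TorusGreenSizeDecay`).
* §1 `rpow_neg_half_max_one_eq_inv_sqrt` (`(1∨s)^{−1∕2} = (√(1∨s))⁻¹`), ★★ `abs_prod_torusHeatKernel_le_three` — `d = 3`: `|∏_μ q^L_s(z_μ)| ≤ K·(1∨s)√(1∨s)·(((1∨s) + z̃_{μ₀}²)³)⁻¹` (three plain factors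
  `(1∨s)^{−1∕2}`, one Gaussian weight kept), `mul_sqrt_mul_inv_cube_le_inv_mul_sqrt` (`T√T·((T+M²)³)⁻¹ ≤ ((s+M²)√(s+M²))⁻¹` for `s ≤ T`).
* §2 ★ `abs_torusGreen_tail_le` (any `d`) — at `S = L²` the Fourier tail of ✓ `torusGreen_eq_integral_add_tail` is `≤ (C₀^d∕8)·L²∕L^d` (`1∕ε_k ≤ L²∕8`, ✓ `eight_div_sq_le_dispersion`).
* §3 ★★★ `torusGreen_mul_dist_le` (`d = 3`) — `∃ C, ∀ L ≥ 1, ∀ z ≠ 0: |G̃_L(z)|·√(Σ_μ z̃_μ²) ≤ C` (`C = √3·(2K + 1∕2 + C₀³∕16)`-shaped, absolute); `torusGreen_mul_dist_le_of_eq` (dimension as a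
  parameter) and the `Site P 0` reading `abs_torusGreen_EK_sub_mul_dist_le` (`|G̃(EK z − EK x)|·√(Σ((EK z − EK x) ν)̃²) ≤ C` for `z ≠ x`).
HONEST SCOPE.  A Literature-grade lattice lemma placed in the Summits lineage that needs it; no Yang–Mills statement is touched.

References: G. F. Lawler, V. Limic, *Random Walk: A Modern Introduction*, CUP 2010, Thm 4.3.1 [LawlerLimic2010]; T. Bałaban, CMP 99 (1985) 75–102 [Balaban1985RegularSpaces] ((1.36) p.82);
CMP 95 (1984) 17–40 [Balaban1984PropagatorsI] (Sect. C p.22).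
-/

set_option autoImplicit false

noncomputable section

open MeasureTheory Set Finset ZMod intervalIntegral
open scoped Real BigOperators

namespace Summit.QuantumFields.YangMills.Theorems.Prop7TorusGreenSizeDecay

open Literature.Probability.LatticeModels
open Prop7TorusGreenGradientBricks (prod_le_apply_of_le_one')
open Prop7TorusGreen2GradientBound (integral_inv_mul_sqrt_le)
open Prop7TorusGreen2HessianDecay (eight_div_sq_le_dispersion)

variable {d L : ℕ}

/-! ## §1 The product heat kernel in `d = 3` -/

/-- `(1∨s)^{−1∕2} = (√(1∨s))⁻¹`. [folklore] -/
theorem rpow_neg_half_max_one_eq_inv_sqrt (s : ℝ) : (max 1 s) ^ (-(1 / 2 : ℝ)) = (Real.sqrt (max 1 s))⁻¹ := by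
  have hT : 0 ≤ max 1 s := le_trans zero_le_one (le_max_left _ _)
  rw [Real.rpow_neg hT, Real.sqrt_eq_rpow]

/-- ★★ **Bound on the product heat kernel of `(ℤ/Lℤ)³`**: there is `K > 0` such that for all `L ≥ 1`, `0 < s ≤ L²`, `z` and every coordinate `μ₀`,
`|∏_μ q^L_s(z_μ)| ≤ K·(1∨s)√(1∨s)·(((1∨s) + z̃_{μ₀}²)³)⁻¹`: three plain factors `(1∨s)^{−1∕2}` and a Gaussian weight `≤ 1` each, the one at `μ₀` kept
(`(1∨s)^{−3∕2}(1 + z̃²∕(1∨s))⁻³ = (1∨s)^{3∕2}((1∨s)+z̃²)⁻³`). [folklore] -/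
theorem abs_prod_torusHeatKernel_le_three : ∃ K : ℝ, 0 < K ∧ ∀ (L : ℕ) [NeZero L] (s : ℝ),
    0 < s → s ≤ (L : ℝ) ^ 2 → ∀ (z : TorusSite 3 L) (μ₀ : Fin 3),
      |∏ μ, torusHeatKernel s (z μ)| ≤ K * (max 1 s * Real.sqrt (max 1 s)) * (((max 1 s) + ((z μ₀).valMinAbs : ℝ) ^ 2) ^ 3)⁻¹ := by
  obtain ⟨K, hK, h₀⟩ := abs_torusHeatKernel_le
  refine ⟨K ^ 3, by positivity, ?_⟩
  intro L _ s hs hsL z μ₀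
  set T : ℝ := max 1 s with hT
  have hT1 : 1 ≤ T := le_max_left _ _
  have hT0 : 0 < T := by positivity
  set σ : ℝ := T ^ (-(1 / 2 : ℝ)) with hσ
  have hσ0 : 0 < σ := Real.rpow_pos_of_pos hT0 _
  have hσ' : σ = (Real.sqrt T)⁻¹ := rpow_neg_half_max_one_eq_inv_sqrt s
  have hsq : Real.sqrt T * Real.sqrt T = T := Real.mul_self_sqrt hT0.le
  have hsq0 : 0 < Real.sqrt T := Real.sqrt_pos.2 hT0
  set W : Fin 3 → ℝ := fun μ => ((1 + ((z μ).valMinAbs : ℝ) ^ 2 / T) ^ 3)⁻¹ with hW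
  have hW0 : ∀ μ, 0 ≤ W μ := fun μ => by positivity
  have hW1 : ∀ μ, W μ ≤ 1 := fun μ => by
    rw [hW]
    exact inv_le_one_of_one_le₀ (one_le_pow₀ (by
      have : 0 ≤ ((z μ).valMinAbs : ℝ) ^ 2 / T := by positivity
      linarith))
  have hWμ₀ : ∏ μ, W μ ≤ W μ₀ := prod_le_apply_of_le_one' hW0 hW1 μ₀
  have b₀ : ∀ m : ZMod L, |torusHeatKernel s m| ≤ K * σ * ((1 + (m.valMinAbs : ℝ) ^ 2 / T) ^ 3)⁻¹ := fun m => h₀ L s hs hsL m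
  -- the target weight
  have htarget : K ^ 3 * σ ^ 3 * W μ₀ = K ^ 3 * (T * Real.sqrt T) * ((T + ((z μ₀).valMinAbs : ℝ) ^ 2) ^ 3)⁻¹ := by
    rw [hW, hσ']
    have hTne : T ≠ 0 := hT0.ne'
    have hsne : Real.sqrt T ≠ 0 := hsq0.ne'
    field_simp
    nlinarith [hsq]
  rw [← htarget, Finset.abs_prod]
  calc ∏ μ, |torusHeatKernel s (z μ)| ≤ ∏ μ, (K * σ * W μ) :=
        Finset.prod_le_prod (fun μ _ => abs_nonneg _) fun μ _ => b₀ (z μ)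
    _ = K ^ 3 * σ ^ 3 * ∏ μ, W μ := by
        rw [Finset.prod_mul_distrib, Finset.prod_const, Finset.card_univ, Fintype.card_fin, mul_pow]
    _ ≤ K ^ 3 * σ ^ 3 * W μ₀ := by gcongr

/-- `T√T·((T + M²)³)⁻¹ ≤ ((s + M²)√(s + M²))⁻¹` for `0 ≤ s ≤ T` (`T ≤ T + M²` and monotonicity). [folklore] -/
theorem mul_sqrt_mul_inv_cube_le_inv_mul_sqrt {s T M : ℝ} (hs : 0 < s) (hsT : s ≤ T) (hM : 0 < M) :
    T * Real.sqrt T * ((T + M ^ 2) ^ 3)⁻¹ ≤ ((s + M ^ 2) * Real.sqrt (s + M ^ 2))⁻¹ := by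
  have hT0 : 0 < T := hs.trans_le hsT
  have hu0 : 0 < s + M ^ 2 := by positivity
  have hv0 : 0 < T + M ^ 2 := by positivity
  have hTv : T ≤ T + M ^ 2 := by nlinarith
  have h1 : T * Real.sqrt T ≤ (T + M ^ 2) * Real.sqrt (T + M ^ 2) :=
    mul_le_mul hTv (Real.sqrt_le_sqrt hTv) (Real.sqrt_nonneg _) hv0.le
  -- `T√T/(T+M²)³ ≤ (T+M²)√(T+M²)/(T+M²)³ = ((T+M²)²/√(T+M²))⁻¹ ≤ ((s+M²)√(s+M²))⁻¹`
  have hsv : Real.sqrt (T + M ^ 2) * Real.sqrt (T + M ^ 2) = T + M ^ 2 := Real.mul_self_sqrt hv0.le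
  have hsv0 : 0 < Real.sqrt (T + M ^ 2) := Real.sqrt_pos.2 hv0
  calc T * Real.sqrt T * ((T + M ^ 2) ^ 3)⁻¹ ≤ (T + M ^ 2) * Real.sqrt (T + M ^ 2) * ((T + M ^ 2) ^ 3)⁻¹ :=
        mul_le_mul_of_nonneg_right h1 (by positivity)
    _ = ((T + M ^ 2) * Real.sqrt (T + M ^ 2))⁻¹ := by
        field_simp
        nlinarith [hsv]
    _ ≤ ((s + M ^ 2) * Real.sqrt (s + M ^ 2))⁻¹ := by
        apply inv_anti₀ (by positivity)
        have hle : s + M ^ 2 ≤ T + M ^ 2 := by linarith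
        exact mul_le_mul hle (Real.sqrt_le_sqrt hle) (Real.sqrt_nonneg _) hv0.le

/-! ## §2 The Fourier tail at `S = L²` -/

variable [NeZero L]

/-- ★ **The Fourier tail of the size representation is `O(L^{2−d})`**: with `C₀ = Σ_{n∈ℤ} 2^{−|n|}`, for all `z`,
`|L^{-d} ∑_{k≠0} cos(p_k·z)·e^{-L²ε_k}/ε_k| ≤ (C₀^d∕8)·L²∕L^d` (`1∕ε_k ≤ L²∕8` by the spectral gap, `e^{−L²ε_k} ≤ ∏_μ 2^{−|k̃_μ|}`). [folklore] -/
theorem abs_torusGreen_tail_le (z : TorusSite d L) :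
    |(∑ k ∈ (univ : Finset (TorusSite d L)).erase 0,
        Real.cos (∑ i, latticeMomentum L k i * ((z i).val : ℝ)) *
          (Real.exp (-((L : ℝ) ^ 2 * dispersion (latticeMomentum L k))) / dispersion (latticeMomentum L k))) / (L : ℝ) ^ d| ≤
      (L : ℝ) ^ 2 / 8 * (∑' n : ℤ, (1 / 2 : ℝ) ^ n.natAbs) ^ d / (L : ℝ) ^ d := by
  classical
  have hL : (0 : ℝ) < L := by exact_mod_cast Nat.pos_of_ne_zero (NeZero.ne L)
  have hLd : (0 : ℝ) < (L : ℝ) ^ d := by positivity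
  rw [abs_div, abs_of_pos hLd, div_le_div_iff_of_pos_right hLd]
  have hterm : ∀ k ∈ (univ : Finset (TorusSite d L)).erase 0,
      |Real.cos (∑ i, latticeMomentum L k i * ((z i).val : ℝ)) *
          (Real.exp (-((L : ℝ) ^ 2 * dispersion (latticeMomentum L k))) / dispersion (latticeMomentum L k))| ≤
        (L : ℝ) ^ 2 / 8 * ∏ μ, (1 / 2 : ℝ) ^ (k μ).valMinAbs.natAbs := by
    intro k hk
    have hk0 : k ≠ 0 := Finset.ne_of_mem_erase hk
    have hε := dispersion_latticeMomentum_pos hk0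
    have hgap := eight_div_sq_le_dispersion k hk0
    rw [abs_mul, abs_div, Real.abs_exp, abs_of_pos hε]
    have hcos : |Real.cos (∑ i, latticeMomentum L k i * ((z i).val : ℝ))| ≤ 1 := Real.abs_cos_le_one _
    have hexp : Real.exp (-((L : ℝ) ^ 2 * dispersion (latticeMomentum L k))) ≤ ∏ μ, (1 / 2 : ℝ) ^ (k μ).valMinAbs.natAbs :=
      (exp_neg_sq_mul_dispersion_le k).trans (Finset.prod_le_prod (fun μ _ => (Real.exp_pos _).le) fun μ _ => exp_neg_eight_mul_sq_le _)
    have hinv : (dispersion (latticeMomentum L k))⁻¹ ≤ (L : ℝ) ^ 2 / 8 := by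
      rw [inv_le_comm₀ hε (by positivity)]
      rw [show ((L : ℝ) ^ 2 / 8)⁻¹ = 8 / (L : ℝ) ^ 2 by rw [inv_div]]
      exact hgap
    calc |Real.cos (∑ i, latticeMomentum L k i * ((z i).val : ℝ))| *
          (Real.exp (-((L : ℝ) ^ 2 * dispersion (latticeMomentum L k))) / dispersion (latticeMomentum L k))
        ≤ 1 * (Real.exp (-((L : ℝ) ^ 2 * dispersion (latticeMomentum L k))) / dispersion (latticeMomentum L k)) := by
          gcongr
      _ = Real.exp (-((L : ℝ) ^ 2 * dispersion (latticeMomentum L k))) * (dispersion (latticeMomentum L k))⁻¹ := by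
          rw [one_mul, div_eq_mul_inv]
      _ ≤ (∏ μ, (1 / 2 : ℝ) ^ (k μ).valMinAbs.natAbs) * ((L : ℝ) ^ 2 / 8) :=
          mul_le_mul hexp hinv (by positivity) (Finset.prod_nonneg fun _ _ => by positivity)
      _ = (L : ℝ) ^ 2 / 8 * ∏ μ, (1 / 2 : ℝ) ^ (k μ).valMinAbs.natAbs := mul_comm _ _
  calc |∑ k ∈ (univ : Finset (TorusSite d L)).erase 0,
        Real.cos (∑ i, latticeMomentum L k i * ((z i).val : ℝ)) *
          (Real.exp (-((L : ℝ) ^ 2 * dispersion (latticeMomentum L k))) / dispersion (latticeMomentum L k))|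
      ≤ ∑ k ∈ (univ : Finset (TorusSite d L)).erase 0, (L : ℝ) ^ 2 / 8 * ∏ μ, (1 / 2 : ℝ) ^ (k μ).valMinAbs.natAbs :=
        (Finset.abs_sum_le_sum_abs _ _).trans (Finset.sum_le_sum hterm)
    _ ≤ ∑ k : TorusSite d L, (L : ℝ) ^ 2 / 8 * ∏ μ, (1 / 2 : ℝ) ^ (k μ).valMinAbs.natAbs :=
        Finset.sum_le_sum_of_subset_of_nonneg (Finset.erase_subset _ _) fun _ _ _ => by positivity
    _ = (L : ℝ) ^ 2 / 8 * (∑ κ : ZMod L, (1 / 2 : ℝ) ^ κ.valMinAbs.natAbs) ^ d := by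
        rw [← Finset.mul_sum]
        congr 1
        rw [show (∑ κ : ZMod L, (1 / 2 : ℝ) ^ κ.valMinAbs.natAbs) ^ d = ∏ _μ : Fin d, ∑ κ : ZMod L, (1 / 2 : ℝ) ^ κ.valMinAbs.natAbs by
          rw [Finset.prod_const, Finset.card_univ, Fintype.card_fin], Finset.prod_univ_sum]
        simp only [Fintype.piFinset_univ]
    _ ≤ (L : ℝ) ^ 2 / 8 * (∑' n : ℤ, (1 / 2 : ℝ) ^ n.natAbs) ^ d := by
        gcongr
        exact sum_half_pow_valMinAbs_le

/-! ## §3 ★★★ The size decay in `d = 3` -/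

omit [NeZero L] in
/-- ★★★ **SIZE DECAY OF THE TORUS GREEN FUNCTION IN `d = 3`, UNIFORMLY IN THE PERIOD.**  There is an absolute constant `C` such that for every `L ≥ 1` and every `z ≠ 0` in
`(ℤ/Lℤ)³`:  `|G̃_L(z)|·√(Σ_μ z̃_μ²) ≤ C`  (`G̃_L = torusGreen`, `z̃_μ = valMinAbs (z μ)`): the lattice, finite-volume form of `|x|⁻¹` (cf. Lawler–Limic 2010 Thm 4.3.1 on `ℤ³`).
Heat-kernel part `≤ K·∫₀^{L²}((s+M²)√(s+M²))⁻¹ds ≤ 2K∕M` (✓ `abs_prod_torusHeatKernel_le_three`, ✓ `integral_inv_mul_sqrt_le`, `M = max_μ|z̃_μ| ≥ 1`), zero-mode term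
`∫₀^{L²}L⁻³ = L⁻¹ ≤ (2M)⁻¹`, Fourier tail `≤ (C₀³∕8)L⁻¹ ≤ (C₀³∕16)M⁻¹` (`2M ≤ L`), and `√(Σz̃²) ≤ √3·M`. [folklore] -/
theorem torusGreen_mul_dist_le : ∃ C : ℝ, ∀ (L : ℕ) [NeZero L] (z : TorusSite 3 L), z ≠ 0 →
    |torusGreen z| * Real.sqrt (∑ k, (((z k).valMinAbs : ℤ) : ℝ) ^ 2) ≤ C := by
  obtain ⟨K, hK, hP⟩ := abs_prod_torusHeatKernel_le_three
  set C₀ : ℝ := ∑' n : ℤ, (1 / 2 : ℝ) ^ n.natAbs with hC₀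
  refine ⟨Real.sqrt 3 * (2 * K + 1 / 2 + C₀ ^ 3 / 16), ?_⟩
  intro L _ z hz
  have hL : (0 : ℝ) < L := by exact_mod_cast Nat.pos_of_ne_zero (NeZero.ne L)
  -- the largest centred coordinate
  obtain ⟨μ₀, -, hμ₀⟩ := Finset.exists_max_image (univ : Finset (Fin 3)) (fun μ => (z μ).valMinAbs.natAbs) Finset.univ_nonempty
  set M : ℝ := |((z μ₀).valMinAbs : ℝ)| with hM
  have hMμ : ∀ μ, |((z μ).valMinAbs : ℝ)| ≤ M := fun μ => by
    have h := hμ₀ μ (Finset.mem_univ μ)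
    rw [hM, ← Int.cast_abs, ← Int.cast_abs, ← Int.natCast_natAbs, ← Int.natCast_natAbs]
    exact_mod_cast h
  have hM1 : 1 ≤ M := by
    obtain ⟨μ₁, hμ₁⟩ : ∃ μ, z μ ≠ 0 := by
      by_contra h
      push Not at h
      exact hz (funext h)
    have h1 : (z μ₁).valMinAbs ≠ 0 := fun h => hμ₁ ((ZMod.valMinAbs_eq_zero _).1 h)
    have h2 : (1 : ℝ) ≤ |((z μ₁).valMinAbs : ℝ)| := by
      rw [← Int.cast_abs]
      exact_mod_cast Int.one_le_abs h1
    exact h2.trans (hMμ μ₁)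
  have hM0 : 0 < M := by linarith
  have hML : 2 * M ≤ L := by
    have h := two_mul_abs_valMinAbs_le (z μ₀)
    rw [hM, ← Int.cast_abs]
    exact_mod_cast h
  -- the distance
  have hdist0 : 0 ≤ ∑ k, (((z k).valMinAbs : ℤ) : ℝ) ^ 2 := Finset.sum_nonneg fun k _ => sq_nonneg _
  have hdist : Real.sqrt (∑ k, (((z k).valMinAbs : ℤ) : ℝ) ^ 2) ≤ Real.sqrt 3 * M := by
    have hsum : ∑ k, (((z k).valMinAbs : ℤ) : ℝ) ^ 2 ≤ 3 * M ^ 2 := by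
      calc ∑ k, (((z k).valMinAbs : ℤ) : ℝ) ^ 2 ≤ ∑ _k : Fin 3, M ^ 2 :=
            Finset.sum_le_sum fun k _ => by
              rw [← sq_abs]
              exact pow_le_pow_left₀ (abs_nonneg _) (hMμ k) 2
        _ = 3 * M ^ 2 := by simp
    calc Real.sqrt (∑ k, (((z k).valMinAbs : ℤ) : ℝ) ^ 2) ≤ Real.sqrt (3 * M ^ 2) := Real.sqrt_le_sqrt hsum
      _ = Real.sqrt 3 * M := by rw [Real.sqrt_mul (by norm_num), Real.sqrt_sq hM0.le]
  -- heat-kernel part, zero-mode term and tail at `S = L²`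
  have hS : (0 : ℝ) ≤ (L : ℝ) ^ 2 := by positivity
  rw [torusGreen_eq_integral_add_tail z ((L : ℝ) ^ 2)]
  have hmain : |∫ s in (0 : ℝ)..(L : ℝ) ^ 2, (∏ i, torusHeatKernel s (z i) - ((L : ℝ) ^ 3)⁻¹)| ≤ 2 * K / M + 1 / L := by
    have hb : ∀ s ∈ Set.Ioc (0 : ℝ) ((L : ℝ) ^ 2),
        |∏ i, torusHeatKernel s (z i) - ((L : ℝ) ^ 3)⁻¹| ≤ K * ((s + M ^ 2) * Real.sqrt (s + M ^ 2))⁻¹ + ((L : ℝ) ^ 3)⁻¹ := by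
      intro s hs
      refine (abs_sub _ _).trans (add_le_add ?_ (le_of_eq (abs_of_pos (by positivity))))
      refine (hP L s hs.1 hs.2 z μ₀).trans ?_
      rw [hM, sq_abs]
      have hc : ((z μ₀).valMinAbs : ℝ) ^ 2 = M ^ 2 := by rw [hM, sq_abs]
      rw [hc, mul_assoc]
      exact mul_le_mul_of_nonneg_left (mul_sqrt_mul_inv_cube_le_inv_mul_sqrt hs.1 (le_max_right _ _) hM0) hK.le
    have hcont : IntervalIntegrable (fun s : ℝ => K * ((s + M ^ 2) * Real.sqrt (s + M ^ 2))⁻¹ + ((L : ℝ) ^ 3)⁻¹) volume 0 ((L : ℝ) ^ 2) := by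
      refine ContinuousOn.intervalIntegrable ?_
      rw [Set.uIcc_of_le hS]
      refine (continuousOn_const.mul (ContinuousOn.inv₀ ((continuousOn_id.add continuousOn_const).mul
        ((continuousOn_id.add continuousOn_const).sqrt)) fun s hs => ?_)).add continuousOn_const
      have h0 : 0 < s + M ^ 2 := by have := hs.1; positivity
      exact (mul_pos h0 (Real.sqrt_pos.2 h0)).ne'
    calc _ ≤ ∫ s in (0 : ℝ)..(L : ℝ) ^ 2, (K * ((s + M ^ 2) * Real.sqrt (s + M ^ 2))⁻¹ + ((L : ℝ) ^ 3)⁻¹) := by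
          have h := intervalIntegral.norm_integral_le_of_norm_le hS
            (Filter.Eventually.of_forall fun s hs => (Real.norm_eq_abs _).le.trans (hb s hs)) hcont
          rwa [Real.norm_eq_abs] at h
      _ = K * (∫ s in (0 : ℝ)..(L : ℝ) ^ 2, ((s + M ^ 2) * Real.sqrt (s + M ^ 2))⁻¹) + ((L : ℝ) ^ 2 - 0) * ((L : ℝ) ^ 3)⁻¹ := by
          rw [intervalIntegral.integral_add, intervalIntegral.integral_const_mul, intervalIntegral.integral_const, smul_eq_mul]
          · exact (ContinuousOn.intervalIntegrable (by
              rw [Set.uIcc_of_le hS]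
              refine continuousOn_const.mul (ContinuousOn.inv₀ ((continuousOn_id.add continuousOn_const).mul
                ((continuousOn_id.add continuousOn_const).sqrt)) fun s hs => ?_)
              have h0 : 0 < s + M ^ 2 := by have := hs.1; positivity
              exact (mul_pos h0 (Real.sqrt_pos.2 h0)).ne'))
          · exact intervalIntegrable_const
      _ ≤ K * (2 / Real.sqrt (M ^ 2)) + 1 / L := by
          have h1 := integral_inv_mul_sqrt_le (c := M ^ 2) (by positivity) hS
          have h2 : ((L : ℝ) ^ 2 - 0) * ((L : ℝ) ^ 3)⁻¹ = 1 / L := by rw [sub_zero]; field_simp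
          rw [h2]
          gcongr
      _ = 2 * K / M + 1 / L := by rw [Real.sqrt_sq hM0.le]; ring
  have htail := abs_torusGreen_tail_le (d := 3) z
  rw [← hC₀] at htail
  -- `1/L ≤ 1/(2M)`, `L²/L³ = 1/L`
  have hL1 : 1 / (L : ℝ) ≤ 1 / (2 * M) := one_div_le_one_div_of_le (by positivity) hML
  have hL3 : (L : ℝ) ^ 2 / 8 * C₀ ^ 3 / (L : ℝ) ^ 3 = C₀ ^ 3 / 8 * (1 / L) := by field_simp
  rw [hL3] at htail
  have hC₀0 : 0 ≤ C₀ := tsum_nonneg fun n => by positivity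
  calc _ ≤ (2 * K / M + 1 / L + C₀ ^ 3 / 8 * (1 / L)) * (Real.sqrt 3 * M) :=
        mul_le_mul ((abs_add_le _ _).trans (add_le_add hmain htail)) hdist (Real.sqrt_nonneg _) (by positivity)
    _ ≤ (2 * K / M + 1 / (2 * M) + C₀ ^ 3 / 8 * (1 / (2 * M))) * (Real.sqrt 3 * M) := by gcongr
    _ = Real.sqrt 3 * (2 * K + 1 / 2 + C₀ ^ 3 / 16) := by
        field_simp
        ring

/-- (G₁-size) with the dimension as a PARAMETER (constant fixed before `d`; `hd : P.d = 3` instantiates without a `Fin` cast). [folklore] -/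
theorem torusGreen_mul_dist_le_of_eq : ∃ C : ℝ, ∀ {d : ℕ} (_ : d = 3) (L : ℕ) [NeZero L] (z : TorusSite d L), z ≠ 0 →
    |torusGreen z| * Real.sqrt (∑ k, (((z k).valMinAbs : ℤ) : ℝ) ^ 2) ≤ C := by
  obtain ⟨C, hC⟩ := torusGreen_mul_dist_le
  refine ⟨C, ?_⟩
  intro d hd
  subst hd
  exact hC

/-- **the `Site P 0` reading** (for ✓ `exists_green_site_split`'s `hLf`): `|G̃(EK z − EK x)|·√(Σ_ν ((EK z − EK x) ν)̃²) ≤ C` for `z ≠ x`, `C` uniform in `P`, `k`.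
[cite: Balaban1985RegularSpaces, (1.36) p.82] -/
theorem abs_torusGreen_EK_sub_mul_dist_le : ∃ C : ℝ, ∀ (P : Literature.MathematicalPhysics.QuantumFieldTheory.Balaban1983to89.Params) (_ : P.d = 3)
    (k : ℕ) (hk : k ≤ P.m + P.K) (x z : Literature.MathematicalPhysics.QuantumFieldTheory.Balaban1983to89.Site P 0), z ≠ x →
      |torusGreen (L := P.L ^ k * P.sitesPerDir k)
          (Literature.MathematicalPhysics.QuantumFieldTheory.Balaban1983to89.B5Eq117TorusCarriers.EK hk z
            - Literature.MathematicalPhysics.QuantumFieldTheory.Balaban1983to89.B5Eq117TorusCarriers.EK hk x)| *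
        Real.sqrt (∑ ν, ((((Literature.MathematicalPhysics.QuantumFieldTheory.Balaban1983to89.B5Eq117TorusCarriers.EK hk z
            - Literature.MathematicalPhysics.QuantumFieldTheory.Balaban1983to89.B5Eq117TorusCarriers.EK hk x) ν).valMinAbs : ℤ) : ℝ) ^ 2) ≤ C := by
  obtain ⟨C, hC⟩ := torusGreen_mul_dist_le_of_eq
  refine ⟨C, ?_⟩
  intro P hd k hk x z hz
  haveI : NeZero (P.L ^ k * P.sitesPerDir k) := ⟨mul_ne_zero (pow_ne_zero _ P.L_pos.ne') (P.sitesPerDir_ne_zero k)⟩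
  have ht : (Literature.MathematicalPhysics.QuantumFieldTheory.Balaban1983to89.B5Eq117TorusCarriers.EK hk z
      - Literature.MathematicalPhysics.QuantumFieldTheory.Balaban1983to89.B5Eq117TorusCarriers.EK hk x :
        TorusSite P.d (P.L ^ k * P.sitesPerDir k)) ≠ 0 := by
    intro h; apply hz
    exact (Literature.MathematicalPhysics.QuantumFieldTheory.Balaban1983to89.B5Eq117TorusCarriers.EK hk).injective (sub_eq_zero.1 h)
  exact hC hd _ _ ht

end Summit.QuantumFields.YangMills.Theorems.Prop7TorusGreenSizeDecay
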